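import Mathlib
import Literature.Analysis.FluidPDE.LocalHelmholtzSupBound
import Literature.Analysis.FluidPDE.LocalTypeI
import Literature.Analysis.FluidPDE.PineauVicolOneSliceVorticity
import Summits.NavierStokesRegularity.NavierStokesRegularity.Theorems.RootDecompLitSliceDarkBallSpreadsHarmonicContinuation
import HarnessLib

/-!
# Route RootDecompLitSlice — brick B6″ of the aside D₁ `DarkBallSpreads`
  (stmt-NavierStokesRegularity-29566; stub `stub_darkBallSpreads` of crux D `NoDarkBall` 29563):
  **a `C²` field that is curl-free and divergence-free on an open set is harmonic there (local
  form of `curl curl = ∇div − Δ`), and the assembled D₁ tail: irrotational + incompressible off a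
  closed `ℋ¹`-null set and dark on a ball ⟹ zero a.e.**

The census ledger (row E20) for D₁ ends, after B0 (`ℋ¹(Σ_T) = 0`, landed), B1–B3 (the terminal
slice `u T` has a `C²` representative `w` on `Ω = ℝ³ ∖ Σ_T` with `div w = 0`) and B4 (ESS backward
unique continuation: `curl w = 0` on the connected `Ω`), with «removability + Weyl + Liouville».
Brick B6′ (`RootDecompLitSliceDarkBallSpreadsHarmonicContinuation`, landed) replaced that tail by
harmonic unique continuation **given `Δ w = 0` on `Ω`**. This file supplies the last local
identity — `curl w = 0 ∧ div w = 0` on an open `U` with `w ∈ C²(U)` ⟹ `Δ w = 0` on `U` — by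
localising the tree's global identity `curl_curl_eq_sum_fderiv_divergence_sub_laplacian`
(Majda–Bertozzi §2.4.1) with a `ContDiffBump` cut-off (curl, divergence and `Δ` at a point depend
only on the germ), and states the assembled tail in the three forms the census assembly can plug:
general closed null set, a.e.-representative, and the backward-singular slice `Σ_t`.

Main results:
* `laplacian_eq_zero_of_curl_eq_zero_of_divergence_eq_zero` (open `U`, `C²` on `U`);
* `eqOn_zero_compl_of_curlFree_divFree_of_darkBall`,
  `ae_eq_zero_of_ae_eq_curlFree_divFree_off_closed_null_of_darkBall`,
  `ae_eq_zero_of_ae_eq_curlFree_divFree_off_backwardSingularSlice_of_darkBall`.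

HONEST FRAMING: vector-calculus glue over landed bricks (B5 census p801378 / writer p801931, B6′
writer p802133); closes no item by itself; rung 0 — nothing here bears on NS regularity.
Lands `--supports stmt-NavierStokesRegularity-29566` (decomp-ns route-writer g15).
-/

set_option linter.dupNamespace false
set_option linter.style.longLine false

noncomputable section

open MeasureTheory Set Metric Filter Topology Function Module
open scoped ENNReal Laplacian
open Literature.Analysis.FluidPDE

namespace Summit.NavierStokesRegularity.NavierStokesRegularity.Theorems

/-! ## Localisation: germ-dependence of `curl`, `div`, `Δ` -/

section Local

/-- A cut-off product `χ • G` with `tsupport χ ⊆ U`, `U` open, `G ∈ Cⁿ(U)` is `Cⁿ` on the whole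
space (copy of the tree's `contDiff_smul_of_tsupport_subset`, kept local to keep the statement
self-contained). [folklore] -/
theorem contDiff_smul_of_tsupport_subset_of_contDiffOn
    {E F : Type*} [NormedAddCommGroup E] [NormedSpace ℝ E] [NormedAddCommGroup F] [NormedSpace ℝ F]
    {χ : E → ℝ} {G : E → F} {U : Set E} {n : WithTop ℕ∞}
    (hU : IsOpen U) (hχ : ContDiff ℝ n χ) (hsupp : tsupport χ ⊆ U) (hG : ContDiffOn ℝ n G U) :
    ContDiff ℝ n fun y => χ y • G y := by
  refine contDiff_iff_contDiffAt.2 fun y => ?_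
  by_cases hy : y ∈ U
  · exact hχ.contDiffAt.smul (hG.contDiffAt (hU.mem_nhds hy))
  · have hy' : y ∉ tsupport χ := fun h => hy (hsupp h)
    have hev : (fun y => χ y • G y) =ᶠ[𝓝 y] fun _ => 0 := by
      filter_upwards [(notMem_tsupport_iff_eventuallyEq.1 hy')] with w hw
      rw [hw, Pi.zero_apply, zero_smul]
    exact contDiffAt_const.congr_of_eventuallyEq hev

/-- `div` depends only on the germ. [folklore] -/
theorem divergence_eventuallyEq_of_eventuallyEq
    {v w : EuclideanSpace ℝ (Fin 3) → EuclideanSpace ℝ (Fin 3)} {x : EuclideanSpace ℝ (Fin 3)}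
    (h : v =ᶠ[𝓝 x] w) :
    VectorCalculus.divergence v =ᶠ[𝓝 x] VectorCalculus.divergence w := by
  filter_upwards [h.eventually_nhds] with z hz
  simp only [VectorCalculus.divergence, Filter.EventuallyEq.fderiv_eq (hz : v =ᶠ[𝓝 z] w)]

/-- The curl of a constant field vanishes. [folklore] -/
theorem curl_const_field (c : EuclideanSpace ℝ (Fin 3)) (x : EuclideanSpace ℝ (Fin 3)) :
    curl (fun _ => c) x = 0 := by
  ext i
  fin_cases i <;> simp [curl]

/-- **Local `curl curl = ∇ div − Δ` consequence.** If `W : ℝ³ → ℝ³` is `C²` on an open set `U`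
with `curl W = 0` and `div W = 0` on `U`, then `Δ W = 0` on `U`. Proof: at `y ∈ U` cut `W` off by a
bump `χ ≡ 1` near `y` supported in `U`; `χ • W ∈ C²(ℝ³)` agrees with `W` near `y`, so the tree's
global identity `curl_curl_eq_sum_fderiv_divergence_sub_laplacian` for `χ • W` at `y` reads
`0 = 0 − ΔW(y)`. [cite: MajdaBertozziCUP2002, §2.4.1 Prop. 2.16] -/
theorem laplacian_eq_zero_of_curl_eq_zero_of_divergence_eq_zero
    {W : EuclideanSpace ℝ (Fin 3) → EuclideanSpace ℝ (Fin 3)} {U : Set (EuclideanSpace ℝ (Fin 3))}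
    (hU : IsOpen U) (hW : ContDiffOn ℝ 2 W U) (hcurl : ∀ x ∈ U, curl W x = 0)
    (hdiv : ∀ x ∈ U, VectorCalculus.divergence W x = 0) :
    ∀ x ∈ U, (Δ W) x = 0 := by
  intro y hy
  obtain ⟨ε, hε, hball⟩ := Metric.isOpen_iff.1 hU y hy
  -- a bump `χ ≡ 1` on `B̄(y, ε/4)`, supported in `B̄(y, ε/2) ⊆ B(y, ε) ⊆ U`
  let χ : ContDiffBump y :=
    { rIn := ε / 4
      rOut := ε / 2
      rIn_pos := by positivity
      rIn_lt_rOut := by linarith }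
  have hsupp : tsupport (χ : EuclideanSpace ℝ (Fin 3) → ℝ) ⊆ U := by
    rw [χ.tsupport_eq]
    exact (closedBall_subset_ball (by show ε / 2 < ε; linarith)).trans hball
  set V : EuclideanSpace ℝ (Fin 3) → EuclideanSpace ℝ (Fin 3) := fun z => χ z • W z with hV_def
  have hV : ContDiff ℝ 2 V :=
    contDiff_smul_of_tsupport_subset_of_contDiffOn hU χ.contDiff hsupp hW
  -- `V = W` near `y`
  have hVW : V =ᶠ[𝓝 y] W := by
    filter_upwards [χ.eventuallyEq_one] with z hz
    simp [hV_def, hz]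
  -- `curl W = 0` and `div W = 0` near `y`
  have hUy : U ∈ 𝓝 y := hU.mem_nhds hy
  have hcurlW : curl W =ᶠ[𝓝 y] fun _ => (0 : EuclideanSpace ℝ (Fin 3)) :=
    Filter.eventuallyEq_of_mem hUy fun z hz => hcurl z hz
  have hdivW : VectorCalculus.divergence W =ᶠ[𝓝 y] fun _ => (0 : ℝ) :=
    Filter.eventuallyEq_of_mem hUy fun z hz => hdiv z hz
  -- transfer to `V`
  have hcurlVW : curl V =ᶠ[𝓝 y] curl W := by
    filter_upwards [hVW.eventually_nhds] with z hz
    exact curl_congr_fderiv (Filter.EventuallyEq.fderiv_eq (hz : V =ᶠ[𝓝 z] W))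
  have hcurlV : curl V =ᶠ[𝓝 y] fun _ => (0 : EuclideanSpace ℝ (Fin 3)) := hcurlVW.trans hcurlW
  have hdivV : VectorCalculus.divergence V =ᶠ[𝓝 y] fun _ => (0 : ℝ) :=
    (divergence_eventuallyEq_of_eventuallyEq hVW).trans hdivW
  have h1 : curl (curl V) y = 0 := by
    rw [curl_congr_fderiv hcurlV.fderiv_eq]
    exact curl_const_field 0 y
  have h2 : fderiv ℝ (VectorCalculus.divergence V) y = 0 := by
    rw [hdivV.fderiv_eq]
    exact fderiv_const_apply (0 : ℝ)
  have h3 : (Δ V) y = (Δ W) y := (InnerProductSpace.laplacian_congr_nhds hVW).eq_of_nhds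
  -- the global identity for `V` at `y`
  have hid := curl_curl_eq_sum_fderiv_divergence_sub_laplacian hV y
  rw [h1, h2, h3] at hid
  simpa using hid

end Local

/-! ## The assembled D₁ tail: irrotational + incompressible off a closed `ℋ¹`-null set -/

section DarkBallTail

/-- **D₁ tail, pointwise form.** `Σ ⊆ ℝ³` closed with `ℋ¹(Σ) = 0`; `w ∈ C²(Σᶜ; ℝ³)` with
`curl w = 0` and `div w = 0` on `Σᶜ`; `w = 0` a.e. on `B(x₀, ρ) ∖ Σ`. Then `w = 0` on `Σᶜ`.
[this file] -/
theorem eqOn_zero_compl_of_curlFree_divFree_of_darkBall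
    {S : Set (EuclideanSpace ℝ (Fin 3))} (hS : IsClosed S) (hnull : μH[1] S = 0)
    {w : EuclideanSpace ℝ (Fin 3) → EuclideanSpace ℝ (Fin 3)} (hw : ContDiffOn ℝ 2 w Sᶜ)
    (hcurl : ∀ x ∈ Sᶜ, curl w x = 0) (hdiv : ∀ x ∈ Sᶜ, VectorCalculus.divergence w x = 0)
    {x₀ : EuclideanSpace ℝ (Fin 3)} {ρ : ℝ} (hρ : 0 < ρ)
    (hdark : ∀ᵐ x ∂(volume.restrict (ball x₀ ρ ∩ Sᶜ)), w x = 0) : EqOn w 0 Sᶜ :=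
  eqOn_zero_compl_of_laplacian_eq_zero_of_darkBall hS hnull hw
    (laplacian_eq_zero_of_curl_eq_zero_of_divergence_eq_zero hS.isOpen_compl hw hcurl hdiv) hρ hdark

/-- **D₁ tail for an a.e.-representative** (the slice `v = u T`, `v = w` a.e. off `Σ`): with
`Σ`, `w` as above, `v = w` a.e. on `Σᶜ` and `v = 0` a.e. on a ball ⟹ `v = 0` a.e. on `ℝ³`.
[this file] -/
theorem ae_eq_zero_of_ae_eq_curlFree_divFree_off_closed_null_of_darkBall
    {S : Set (EuclideanSpace ℝ (Fin 3))} (hS : IsClosed S) (hnull : μH[1] S = 0)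
    {v w : EuclideanSpace ℝ (Fin 3) → EuclideanSpace ℝ (Fin 3)} (hw : ContDiffOn ℝ 2 w Sᶜ)
    (hcurl : ∀ x ∈ Sᶜ, curl w x = 0) (hdiv : ∀ x ∈ Sᶜ, VectorCalculus.divergence w x = 0)
    (hvw : ∀ᵐ x ∂(volume.restrict Sᶜ), v x = w x)
    {x₀ : EuclideanSpace ℝ (Fin 3)} {ρ : ℝ} (hρ : 0 < ρ)
    (hdark : ∀ᵐ x ∂(volume.restrict (ball x₀ ρ)), v x = 0) :
    ∀ᵐ x ∂(volume : Measure (EuclideanSpace ℝ (Fin 3))), v x = 0 :=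
  ae_eq_zero_of_ae_eq_harmonic_off_closed_null_of_darkBall hS hnull hw
    (laplacian_eq_zero_of_curl_eq_zero_of_divergence_eq_zero hS.isOpen_compl hw hcurl hdiv) hvw hρ
    hdark

/-- **D₁ tail on the backward-singular slice** `Σ_t = {x | IsBackwardSingularPoint u (t, x)}`
(closed; `ℋ¹`-null by brick B0 for the terminal slice of a Clay-class solution): if the slice `v`
agrees a.e. off `Σ_t` with a field `w ∈ C²(Σ_tᶜ)` that is curl-free (B4, ESS) and divergence-free
(B1–B3) there, and `v = 0` a.e. on a ball, then `v = 0` a.e. on `ℝ³`. [this file] -/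
theorem ae_eq_zero_of_ae_eq_curlFree_divFree_off_backwardSingularSlice_of_darkBall
    (u : ℝ → (EuclideanSpace ℝ (Fin 3)) → (EuclideanSpace ℝ (Fin 3))) (t : ℝ)
    (hnull : μH[1] {x : EuclideanSpace ℝ (Fin 3) | IsBackwardSingularPoint u (t, x)} = 0)
    {v w : EuclideanSpace ℝ (Fin 3) → EuclideanSpace ℝ (Fin 3)}
    (hw : ContDiffOn ℝ 2 w {x : EuclideanSpace ℝ (Fin 3) | IsBackwardSingularPoint u (t, x)}ᶜ)
    (hcurl : ∀ x ∈ {x : EuclideanSpace ℝ (Fin 3) | IsBackwardSingularPoint u (t, x)}ᶜ, curl w x = 0)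
    (hdiv : ∀ x ∈ {x : EuclideanSpace ℝ (Fin 3) | IsBackwardSingularPoint u (t, x)}ᶜ,
      VectorCalculus.divergence w x = 0)
    (hvw : ∀ᵐ x ∂(volume.restrict {x : EuclideanSpace ℝ (Fin 3) | IsBackwardSingularPoint u (t, x)}ᶜ),
      v x = w x)
    {x₀ : EuclideanSpace ℝ (Fin 3)} {ρ : ℝ} (hρ : 0 < ρ)
    (hdark : ∀ᵐ x ∂(volume.restrict (ball x₀ ρ)), v x = 0) :
    ∀ᵐ x ∂(volume : Measure (EuclideanSpace ℝ (Fin 3))), v x = 0 :=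
  ae_eq_zero_of_ae_eq_curlFree_divFree_off_closed_null_of_darkBall
    (isClosed_backwardSingularSlice u t) hnull hw hcurl hdiv hvw hρ hdark

end DarkBallTail

end Summit.NavierStokesRegularity.NavierStokesRegularity.Theorems
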